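import Summits.ValiantsHypothesis.ValiantsHypothesis.Theorems.DefinabilityGapPatternCounts
import HarnessLib

/-!
# DefinabilityGap — the one-block coin-domination step of the refined cover count

Route `route-ValiantsHypothesis-DefinabilityGap` (decomp-valiant, lens 5), supporting `KIPlantedHitting`
(stmt-ValiantsHypothesis-23547). Source: decomp-valiant lens-5 g16, NOTE-g16 §3.4 (refined Lemma 3) / §4b.

A block with cell set `T0 ⊆ Fin m × Fin m`, `|T0| ≤ 2` (for the generator: the cells it shares with a fixed host) and a
uniform pattern `ρ ∈ S_m` COVERS column `a` if `(ρ a, a) ∈ T0`. With `c = (m−2)/(m−1)` and `φ(n) = 1 − cⁿ` (the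
probability that at least one of `n` independent Bernoulli(`1/(m−1)`) coins is on), MAIN RESULT `block_step`:
`Σ_ρ ∏_{a ∈ A} [ρ covers a ? 1 : φ(n'_a)] ≤ m! · ∏_{a ∈ A} φ(n'_a + #(T0 ∩ column a))` — one block's permutation may be
replaced by independent coins on its cells without decreasing any such "coverage functional". Cases: the block meets `A`
in no cell / one column (one or two rows; `sum_ite_mem_le`, using `#{ρ : ρ a = x}·m = m!`) / two columns
(`sum_ite_mul_ite_le`, using also `#{ρ : ρ a₁ = x₁, ρ a₂ = x₂}·(m−1)² ≤ m!`). Used by `DefinabilityGapCoverCount`.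
0 sorry; VP ≠ VNP untouched.
-/

set_option linter.dupNamespace false

noncomputable section

open Summit.ValiantsHypothesis.ValiantsHypothesis.Theorems.DefinabilityGapPatternCounts

namespace Summit.ValiantsHypothesis.ValiantsHypothesis.Theorems.DefinabilityGapBlockStep

variable {m : ℕ}

/-! ## 1. The coin parameter `c = (m−2)/(m−1)` and `φ(n) = 1 − cⁿ` -/

/-- `c = (m−2)/(m−1)`: the probability that one Bernoulli(`1/(m−1)`) coin is off. [this file] -/
def cbase (m : ℕ) : ℝ := ((m : ℝ) - 2) / ((m : ℝ) - 1)

/-- `φ(n) = 1 − cⁿ`: the probability that at least one of `n` coins is on. [this file] -/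
def phi (m n : ℕ) : ℝ := 1 - cbase m ^ n

/-- `0 ≤ c`. [this file] -/
theorem cbase_nonneg (hm : 3 ≤ m) : 0 ≤ cbase m := by
  have h3 : (3 : ℝ) ≤ m := by exact_mod_cast hm
  unfold cbase
  exact div_nonneg (by linarith) (by linarith)

/-- `c ≤ 1`. [this file] -/
theorem cbase_le_one (hm : 3 ≤ m) : cbase m ≤ 1 := by
  have h3 : (3 : ℝ) ≤ m := by exact_mod_cast hm
  unfold cbase
  rw [div_le_one (by linarith)]
  linarith

/-- `0 ≤ φ(n)`. [this file] -/
theorem phi_nonneg (hm : 3 ≤ m) (n : ℕ) : 0 ≤ phi m n :=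
  sub_nonneg.2 (pow_le_one₀ (cbase_nonneg hm) (cbase_le_one hm))

/-- `φ(n) ≤ 1`. [this file] -/
theorem phi_le_one (hm : 3 ≤ m) (n : ℕ) : phi m n ≤ 1 :=
  sub_le_self _ (pow_nonneg (cbase_nonneg hm) n)

/-- The one-block domination constants: `c^t ≤ 1 − t/m` for `t ≤ 2`. [this file] -/
theorem cbase_pow_le (hm : 3 ≤ m) {t : ℕ} (ht : t ≤ 2) : cbase m ^ t ≤ 1 - (t : ℝ) / m := by
  have h3 : (3 : ℝ) ≤ m := by exact_mod_cast hm
  have hm0 : (0 : ℝ) < m := by linarith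
  have hm1 : (0 : ℝ) < (m : ℝ) - 1 := by linarith
  interval_cases t
  · simp
  · have h : 1 - (1 : ℝ) / m - cbase m ^ 1 = 1 / (m * ((m : ℝ) - 1)) := by
      unfold cbase; field_simp; ring
    have hpos : 0 ≤ 1 / (m * ((m : ℝ) - 1)) := by positivity
    simp only [Nat.cast_one]
    linarith
  · have h : 1 - (2 : ℝ) / m - cbase m ^ 2 = ((m : ℝ) - 2) / (m * ((m : ℝ) - 1) ^ 2) := by
      unfold cbase; field_simp; ring
    have hpos : 0 ≤ ((m : ℝ) - 2) / (m * ((m : ℝ) - 1) ^ 2) := div_nonneg (by linarith) (by positivity)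
    simp only [Nat.cast_ofNat]
    linarith

/-! ## 2. Column counts -/

/-- `#(T ∩ column a)`. [this file] -/
def colCount (T : Finset (Fin m × Fin m)) (a : Fin m) : ℕ := by
  classical
  exact (T.filter fun x => x.2 = a).card

/-- `Σ_a #(T ∩ column a) = |T|`. [folklore] -/
theorem sum_colCount (T : Finset (Fin m × Fin m)) : ∑ a, colCount T a = T.card := by
  classical
  unfold colCount
  exact (Finset.card_eq_sum_card_fiberwise (f := Prod.snd) (t := Finset.univ) fun _ _ => Finset.mem_univ _).symm

/-! ## 3. One block, one column: `Σ_ρ [ρ a₁ ∈ R ? 1 : φ(n)] ≤ m!·φ(n + |R|)` for `|R| ≤ 2` -/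

/-- `#{ρ : ρ a₁ ∈ R}·m = |R|·m!`. [folklore] -/
theorem card_filter_apply_mem_mul (a₁ : Fin m) (R : Finset (Fin m)) :
    (Finset.univ.filter fun ρ : Equiv.Perm (Fin m) => ρ a₁ ∈ R).card * m = R.card * Nat.factorial m := by
  classical
  have hfib := Finset.card_eq_sum_card_fiberwise (s := Finset.univ.filter fun ρ : Equiv.Perm (Fin m) => ρ a₁ ∈ R)
    (t := R) (f := fun ρ => ρ a₁) fun ρ hρ => (Finset.mem_filter.1 hρ).2
  have hf : ∀ r ∈ R, ((Finset.univ.filter fun ρ : Equiv.Perm (Fin m) => ρ a₁ ∈ R).filter fun ρ => ρ a₁ = r) =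
      Finset.univ.filter fun ρ : Equiv.Perm (Fin m) => ρ a₁ = r := by
    intro r hr
    ext ρ
    simp only [Finset.mem_filter, Finset.mem_univ, true_and]
    exact ⟨fun h => h.2, fun h => ⟨h ▸ hr, h⟩⟩
  rw [hfib, Finset.sum_mul, Finset.sum_congr rfl fun r hr => by rw [hf r hr, card_filter_apply_mul a₁ r],
    Finset.sum_const, smul_eq_mul]

/-- One column: `Σ_ρ [ρ a₁ ∈ R ? 1 : φ(n)] ≤ m!·φ(n + |R|)` (`|R| ≤ 2`). [this file] -/
theorem sum_ite_mem_le (hm : 3 ≤ m) (a₁ : Fin m) (R : Finset (Fin m)) (hR : R.card ≤ 2) (n : ℕ) :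
    ∑ ρ : Equiv.Perm (Fin m), (if ρ a₁ ∈ R then (1 : ℝ) else phi m n) ≤
      Nat.factorial m * phi m (n + R.card) := by
  classical
  have h3 : (3 : ℝ) ≤ m := by exact_mod_cast hm
  have hm0 : (0 : ℝ) < m := by linarith
  set F : ℝ := (Nat.factorial m : ℝ) with hF
  have hA : (((Finset.univ.filter fun ρ : Equiv.Perm (Fin m) => ρ a₁ ∈ R).card : ℕ) : ℝ) = R.card * F / m := by
    rw [eq_div_iff hm0.ne', hF]
    exact_mod_cast card_filter_apply_mem_mul a₁ R
  have hB : (((Finset.univ.filter fun ρ : Equiv.Perm (Fin m) => ¬ ρ a₁ ∈ R).card : ℕ) : ℝ) = F - R.card * F / m := by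
    have h := Finset.card_filter_add_card_filter_not (s := (Finset.univ : Finset (Equiv.Perm (Fin m))))
      (fun ρ : Equiv.Perm (Fin m) => ρ a₁ ∈ R)
    rw [Finset.card_univ, Fintype.card_perm, Fintype.card_fin] at h
    rw [← hA, hF, eq_sub_iff_add_eq, add_comm]
    exact_mod_cast h
  rw [Finset.sum_ite, Finset.sum_const, Finset.sum_const, nsmul_eq_mul, nsmul_eq_mul, mul_one, hA, hB]
  -- `tF/m + (F − tF/m)(1 − cⁿ) ≤ F (1 − cⁿ⁺ᵗ)` with `cᵗ ≤ 1 − t/m`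
  have hct := cbase_pow_le hm hR
  have hcn : 0 ≤ cbase m ^ n := pow_nonneg (cbase_nonneg hm) n
  have hF0 : 0 ≤ F := by rw [hF]; exact_mod_cast (Nat.factorial_pos m).le
  unfold phi
  rw [pow_add]
  have key : F * (cbase m ^ n * cbase m ^ R.card) ≤ F * (cbase m ^ n * (1 - (R.card : ℝ) / m)) :=
    mul_le_mul_of_nonneg_left (mul_le_mul_of_nonneg_left hct hcn) hF0
  have hexp : (R.card : ℝ) * F / m + (F - R.card * F / m) * (1 - cbase m ^ n) =
      F - F * (cbase m ^ n * (1 - (R.card : ℝ) / m)) := by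
    field_simp
    ring
  rw [hexp]
  linarith

/-! ## 4. One block, two columns -/

/-- Two columns: `Σ_ρ [ρ a₁ = r₁ ? 1 : φ(n₁)]·[ρ a₂ = r₂ ? 1 : φ(n₂)] ≤ m!·φ(n₁+1)·φ(n₂+1)` (`a₁ ≠ a₂`). [this file] -/
theorem sum_ite_mul_ite_le (hm : 3 ≤ m) {a₁ a₂ : Fin m} (ha : a₁ ≠ a₂) (r₁ r₂ : Fin m) (n₁ n₂ : ℕ) :
    ∑ ρ : Equiv.Perm (Fin m), (if ρ a₁ = r₁ then (1 : ℝ) else phi m n₁) * (if ρ a₂ = r₂ then 1 else phi m n₂) ≤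
      Nat.factorial m * (phi m (n₁ + 1) * phi m (n₂ + 1)) := by
  classical
  have h3 : (3 : ℝ) ≤ m := by exact_mod_cast hm
  have hm0 : (0 : ℝ) < m := by linarith
  have hm1 : (0 : ℝ) < (m : ℝ) - 1 := by linarith
  set F : ℝ := (Nat.factorial m : ℝ) with hF
  set x₁ : ℝ := cbase m ^ n₁ with hx₁
  set x₂ : ℝ := cbase m ^ n₂ with hx₂
  have hx₁0 : 0 ≤ x₁ := pow_nonneg (cbase_nonneg hm) _
  have hx₂0 : 0 ≤ x₂ := pow_nonneg (cbase_nonneg hm) _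
  have hx₁1 : x₁ ≤ 1 := pow_le_one₀ (cbase_nonneg hm) (cbase_le_one hm)
  have hx₂1 : x₂ ≤ 1 := pow_le_one₀ (cbase_nonneg hm) (cbase_le_one hm)
  -- indicators
  set I₁ : Equiv.Perm (Fin m) → ℝ := fun ρ => if ρ a₁ = r₁ then 1 else 0 with hI₁
  set I₂ : Equiv.Perm (Fin m) → ℝ := fun ρ => if ρ a₂ = r₂ then 1 else 0 with hI₂
  have hg₁ : ∀ ρ : Equiv.Perm (Fin m), (if ρ a₁ = r₁ then (1 : ℝ) else phi m n₁) = (1 - x₁) + x₁ * I₁ ρ := by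
    intro ρ; simp only [hI₁, phi]; split_ifs <;> ring
  have hg₂ : ∀ ρ : Equiv.Perm (Fin m), (if ρ a₂ = r₂ then (1 : ℝ) else phi m n₂) = (1 - x₂) + x₂ * I₂ ρ := by
    intro ρ; simp only [hI₂, phi]; split_ifs <;> ring
  -- the three counts
  set N₁ : ℝ := ((Finset.univ.filter fun ρ : Equiv.Perm (Fin m) => ρ a₁ = r₁).card : ℝ) with hN₁
  set N₂ : ℝ := ((Finset.univ.filter fun ρ : Equiv.Perm (Fin m) => ρ a₂ = r₂).card : ℝ) with hN₂
  set N₁₂ : ℝ := ((Finset.univ.filter fun ρ : Equiv.Perm (Fin m) => ρ a₁ = r₁ ∧ ρ a₂ = r₂).card : ℝ) with hN₁₂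
  have hS₁ : ∑ ρ : Equiv.Perm (Fin m), I₁ ρ = N₁ := by
    rw [hN₁, hI₁, Finset.sum_boole]
  have hS₂ : ∑ ρ : Equiv.Perm (Fin m), I₂ ρ = N₂ := by
    rw [hN₂, hI₂, Finset.sum_boole]
  have hS₁₂ : ∑ ρ : Equiv.Perm (Fin m), I₁ ρ * I₂ ρ = N₁₂ := by
    rw [hN₁₂, ← Finset.sum_boole]
    refine Finset.sum_congr rfl fun ρ _ => ?_
    simp only [hI₁, hI₂]
    split_ifs <;> simp_all
  have hN₁e : N₁ = F / m := by
    rw [eq_div_iff hm0.ne', hN₁, hF]; exact_mod_cast card_filter_apply_mul a₁ r₁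
  have hN₂e : N₂ = F / m := by
    rw [eq_div_iff hm0.ne', hN₂, hF]; exact_mod_cast card_filter_apply_mul a₂ r₂
  have hN₁₂le : N₁₂ * ((m : ℝ) - 1) ^ 2 ≤ F := by
    have h := card_filter_apply₂_mul_le ha r₁ r₂
    have h' : (((Finset.univ.filter fun ρ : Equiv.Perm (Fin m) => ρ a₁ = r₁ ∧ ρ a₂ = r₂).card : ℕ) : ℝ) *
        (((m - 1 : ℕ) : ℝ) * ((m - 1 : ℕ) : ℝ)) ≤ (Nat.factorial m : ℝ) := by exact_mod_cast h
    have hsub : ((m - 1 : ℕ) : ℝ) = (m : ℝ) - 1 := by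
      rw [Nat.cast_sub (by omega : 1 ≤ m), Nat.cast_one]
    rw [hsub] at h'
    rw [hN₁₂, hF, sq]
    exact h'
  -- expand the sum
  have hexp : ∑ ρ : Equiv.Perm (Fin m), (if ρ a₁ = r₁ then (1 : ℝ) else phi m n₁) * (if ρ a₂ = r₂ then 1 else phi m n₂)
      = F * (1 - x₁) * (1 - x₂) + (1 - x₁) * x₂ * N₂ + x₁ * (1 - x₂) * N₁ + x₁ * x₂ * N₁₂ := by
    simp_rw [hg₁, hg₂]
    have hterm : ∀ ρ : Equiv.Perm (Fin m), ((1 - x₁) + x₁ * I₁ ρ) * ((1 - x₂) + x₂ * I₂ ρ) =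
        (1 - x₁) * (1 - x₂) + (1 - x₁) * x₂ * I₂ ρ + x₁ * (1 - x₂) * I₁ ρ + x₁ * x₂ * (I₁ ρ * I₂ ρ) := by
      intro ρ; ring
    simp_rw [hterm]
    rw [Finset.sum_add_distrib, Finset.sum_add_distrib, Finset.sum_add_distrib, Finset.sum_const, Finset.card_univ,
      Fintype.card_perm, Fintype.card_fin, nsmul_eq_mul, ← Finset.mul_sum, ← Finset.mul_sum, ← Finset.mul_sum,
      hS₁, hS₂, hS₁₂, hF]
    ring
  rw [hexp, hN₁e, hN₂e]
  -- replace `N₁₂` by its bound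
  have hstep : x₁ * x₂ * N₁₂ ≤ x₁ * x₂ * (F / ((m : ℝ) - 1) ^ 2) := by
    refine mul_le_mul_of_nonneg_left ?_ (mul_nonneg hx₁0 hx₂0)
    rw [le_div_iff₀ (by positivity)]
    exact hN₁₂le
  -- the polynomial inequality: difference = F (m−1)(x₁(1−x₂) + x₂(1−x₁)) / (m (m−1)²) ≥ 0
  have hF0 : 0 ≤ F := by rw [hF]; exact_mod_cast (Nat.factorial_pos m).le
  have hphi₁ : phi m (n₁ + 1) = 1 - cbase m * x₁ := by simp only [phi, hx₁, pow_succ]; ring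
  have hphi₂ : phi m (n₂ + 1) = 1 - cbase m * x₂ := by simp only [phi, hx₂, pow_succ]; ring
  rw [hphi₁, hphi₂]
  have hdiff : F * ((1 - cbase m * x₁) * (1 - cbase m * x₂)) -
      (F * (1 - x₁) * (1 - x₂) + (1 - x₁) * x₂ * (F / m) + x₁ * (1 - x₂) * (F / m) + x₁ * x₂ * (F / ((m : ℝ) - 1) ^ 2))
      = F * (((m : ℝ) - 1) * (x₁ * (1 - x₂) + x₂ * (1 - x₁))) / (m * ((m : ℝ) - 1) ^ 2) := by
    unfold cbase
    field_simp
    ring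
  have hnonneg : 0 ≤ F * (((m : ℝ) - 1) * (x₁ * (1 - x₂) + x₂ * (1 - x₁))) / (m * ((m : ℝ) - 1) ^ 2) := by
    apply div_nonneg _ (by positivity)
    apply mul_nonneg hF0
    apply mul_nonneg hm1.le
    nlinarith [mul_nonneg hx₁0 (sub_nonneg.2 hx₂1), mul_nonneg hx₂0 (sub_nonneg.2 hx₁1)]
  linarith [hstep, hdiff, hnonneg]

/-! ## 5. One block against a column set -/

/-- All cells of the block lie in ONE column `a₁ ∈ A` (one or two rows). [this file] -/
theorem block_step_oneCol (hm : 3 ≤ m) (T0 : Finset (Fin m × Fin m)) (hT0 : T0.card ≤ 2) {a₁ : Fin m}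
    (hcol : ∀ x ∈ T0, x.2 = a₁) (A : Finset (Fin m)) (ha₁ : a₁ ∈ A) (n' : Fin m → ℕ) :
    ∑ ρ : Equiv.Perm (Fin m), ∏ a ∈ A, (if (ρ a, a) ∈ T0 then (1 : ℝ) else phi m (n' a)) ≤
      Nat.factorial m * ∏ a ∈ A, phi m (n' a + colCount T0 a) := by
  classical
  set R : Finset (Fin m) := T0.image Prod.fst with hR
  have hmemT : ∀ (r a : Fin m), (r, a) ∈ T0 ↔ a = a₁ ∧ r ∈ R := by
    intro r a
    constructor
    · intro h
      exact ⟨hcol _ h, Finset.mem_image.2 ⟨(r, a), h, rfl⟩⟩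
    · rintro ⟨rfl, hr⟩
      obtain ⟨x, hx, hx1⟩ := Finset.mem_image.1 hr
      have hx2 := hcol x hx
      have : x = (r, a) := Prod.ext hx1 hx2
      rw [← this]; exact hx
  have hRcard : R.card = T0.card := by
    refine Finset.card_image_of_injOn fun x hx y hy hxy => ?_
    exact Prod.ext hxy ((hcol x hx).trans (hcol y hy).symm)
  have hcc₁ : colCount T0 a₁ = T0.card := by
    unfold colCount; rw [Finset.filter_true_of_mem fun x hx => hcol x hx]
  have hcc : ∀ a, a ≠ a₁ → colCount T0 a = 0 := by
    intro a ha
    unfold colCount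
    rw [Finset.card_eq_zero, Finset.filter_eq_empty_iff]
    intro x hx hxa
    exact ha (hxa.symm.trans (hcol x hx))
  -- factor both sides at `a₁`
  set P : ℝ := ∏ a ∈ A.erase a₁, phi m (n' a) with hP
  have hP0 : 0 ≤ P := Finset.prod_nonneg fun a _ => phi_nonneg hm _
  have hL : ∀ ρ : Equiv.Perm (Fin m), ∏ a ∈ A, (if (ρ a, a) ∈ T0 then (1 : ℝ) else phi m (n' a)) =
      (if ρ a₁ ∈ R then (1 : ℝ) else phi m (n' a₁)) * P := by
    intro ρ
    rw [← Finset.mul_prod_erase A _ ha₁]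
    congr 1
    · simp only [hmemT, true_and]
    · refine Finset.prod_congr rfl fun a ha => ?_
      have hne : a ≠ a₁ := (Finset.mem_erase.1 ha).1
      rw [if_neg (fun h => hne ((hmemT _ _).1 h).1)]
  have hRHS : ∏ a ∈ A, phi m (n' a + colCount T0 a) = phi m (n' a₁ + R.card) * P := by
    rw [← Finset.mul_prod_erase A _ ha₁, hcc₁, hRcard]
    congr 1
    refine Finset.prod_congr rfl fun a ha => ?_
    rw [hcc a (Finset.mem_erase.1 ha).1, add_zero]
  simp_rw [hL]
  rw [← Finset.sum_mul, hRHS, ← mul_assoc]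
  exact mul_le_mul_of_nonneg_right (sum_ite_mem_le hm a₁ R (hRcard ▸ hT0) (n' a₁)) hP0

/-- The block has one cell in each of TWO columns `a₁ ≠ a₂` of `A`. [this file] -/
theorem block_step_twoCol (hm : 3 ≤ m) {r₁ r₂ a₁ a₂ : Fin m} (ha : a₁ ≠ a₂) (A : Finset (Fin m)) (ha₁ : a₁ ∈ A)
    (ha₂ : a₂ ∈ A) (n' : Fin m → ℕ) :
    ∑ ρ : Equiv.Perm (Fin m), ∏ a ∈ A, (if (ρ a, a) ∈ ({(r₁, a₁), (r₂, a₂)} : Finset (Fin m × Fin m)) then (1 : ℝ)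
        else phi m (n' a)) ≤
      Nat.factorial m * ∏ a ∈ A, phi m (n' a + colCount ({(r₁, a₁), (r₂, a₂)} : Finset (Fin m × Fin m)) a) := by
  classical
  have ha₂' : a₂ ∈ A.erase a₁ := Finset.mem_erase.2 ⟨fun h => ha h.symm, ha₂⟩
  have hmem : ∀ (r a : Fin m), (r, a) ∈ ({(r₁, a₁), (r₂, a₂)} : Finset (Fin m × Fin m)) ↔
      (r = r₁ ∧ a = a₁) ∨ (r = r₂ ∧ a = a₂) := by
    intro r a; simp [Prod.ext_iff]
  have hcc₁ : colCount ({(r₁, a₁), (r₂, a₂)} : Finset (Fin m × Fin m)) a₁ = 1 := by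
    unfold colCount
    rw [Finset.filter_insert, if_pos rfl, Finset.filter_singleton, if_neg (fun h : a₂ = a₁ => ha h.symm),
      Finset.card_insert_of_notMem (Finset.notMem_empty _), Finset.card_empty]
  have hcc₂ : colCount ({(r₁, a₁), (r₂, a₂)} : Finset (Fin m × Fin m)) a₂ = 1 := by
    unfold colCount
    rw [Finset.filter_insert, if_neg (fun h : a₁ = a₂ => ha h), Finset.filter_singleton, if_pos rfl,
      Finset.card_singleton]
  have hcc : ∀ a, a ≠ a₁ → a ≠ a₂ → colCount ({(r₁, a₁), (r₂, a₂)} : Finset (Fin m × Fin m)) a = 0 := by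
    intro a h1 h2
    unfold colCount
    rw [Finset.card_eq_zero, Finset.filter_eq_empty_iff]
    intro x hx hxa
    rcases (hmem x.1 x.2).1 (by simpa using hx) with ⟨_, h⟩ | ⟨_, h⟩
    · exact h1 (hxa.symm.trans h)
    · exact h2 (hxa.symm.trans h)
  set P : ℝ := ∏ a ∈ (A.erase a₁).erase a₂, phi m (n' a) with hP
  have hP0 : 0 ≤ P := Finset.prod_nonneg fun a _ => phi_nonneg hm _
  have hL : ∀ ρ : Equiv.Perm (Fin m),
      ∏ a ∈ A, (if (ρ a, a) ∈ ({(r₁, a₁), (r₂, a₂)} : Finset (Fin m × Fin m)) then (1 : ℝ) else phi m (n' a)) =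
      ((if ρ a₁ = r₁ then (1 : ℝ) else phi m (n' a₁)) * (if ρ a₂ = r₂ then 1 else phi m (n' a₂))) * P := by
    intro ρ
    rw [← Finset.mul_prod_erase A _ ha₁, ← Finset.mul_prod_erase (A.erase a₁) _ ha₂', mul_assoc]
    congr 1
    · simp only [hmem, and_true, ha, and_false, or_false]
    · congr 1
      · simp only [hmem, and_true, Ne.symm ha, and_false, false_or]
      · refine Finset.prod_congr rfl fun a hmemA => ?_
        have h2 : a ≠ a₂ := (Finset.mem_erase.1 hmemA).1
        have h1 : a ≠ a₁ := (Finset.mem_erase.1 (Finset.mem_erase.1 hmemA).2).1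
        rw [if_neg]
        intro h
        rcases (hmem _ _).1 h with ⟨_, h'⟩ | ⟨_, h'⟩
        · exact h1 h'
        · exact h2 h'
  have hRHS : ∏ a ∈ A, phi m (n' a + colCount ({(r₁, a₁), (r₂, a₂)} : Finset (Fin m × Fin m)) a) =
      (phi m (n' a₁ + 1) * phi m (n' a₂ + 1)) * P := by
    rw [← Finset.mul_prod_erase A _ ha₁, ← Finset.mul_prod_erase (A.erase a₁) _ ha₂', hcc₁, hcc₂, mul_assoc]
    congr 2
    refine Finset.prod_congr rfl fun a hmemA => ?_
    have h2 : a ≠ a₂ := (Finset.mem_erase.1 hmemA).1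
    have h1 : a ≠ a₁ := (Finset.mem_erase.1 (Finset.mem_erase.1 hmemA).2).1
    rw [hcc a h1 h2, add_zero]
  simp_rw [hL]
  rw [← Finset.sum_mul, hRHS, ← mul_assoc]
  exact mul_le_mul_of_nonneg_right (sum_ite_mul_ite_le hm ha r₁ r₂ (n' a₁) (n' a₂)) hP0

/-- **One-block step** (any block with `≤ 2` cells, any column set `A`):
`Σ_ρ ∏_{a ∈ A} [ρ covers a ? 1 : φ(n'_a)] ≤ m! · ∏_{a ∈ A} φ(n'_a + #(T0 ∩ column a))`. [this file] -/
theorem block_step (hm : 3 ≤ m) (T0 : Finset (Fin m × Fin m)) (hT0 : T0.card ≤ 2) (A : Finset (Fin m))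
    (n' : Fin m → ℕ) :
    ∑ ρ : Equiv.Perm (Fin m), ∏ a ∈ A, (if (ρ a, a) ∈ T0 then (1 : ℝ) else phi m (n' a)) ≤
      Nat.factorial m * ∏ a ∈ A, phi m (n' a + colCount T0 a) := by
  classical
  -- only the cells with column in `A` matter
  set T1 : Finset (Fin m × Fin m) := T0.filter fun x => x.2 ∈ A with hT1
  have hT1card : T1.card ≤ 2 := (Finset.card_filter_le _ _).trans hT0
  have hT1col : ∀ x ∈ T1, x.2 ∈ A := fun x hx => (Finset.mem_filter.1 hx).2
  have hmem1 : ∀ (ρ : Equiv.Perm (Fin m)) (a : Fin m), a ∈ A → ((ρ a, a) ∈ T0 ↔ (ρ a, a) ∈ T1) := by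
    intro ρ a ha
    rw [hT1, Finset.mem_filter]
    exact ⟨fun h => ⟨h, ha⟩, fun h => h.1⟩
  have hcc1 : ∀ a ∈ A, colCount T0 a = colCount T1 a := by
    intro a ha
    unfold colCount
    rw [hT1, Finset.filter_filter]
    congr 1
    refine Finset.filter_congr fun x _ => ⟨fun h => ⟨h ▸ ha, h⟩, fun h => h.2⟩
  have hLHS : ∀ ρ : Equiv.Perm (Fin m), ∏ a ∈ A, (if (ρ a, a) ∈ T0 then (1 : ℝ) else phi m (n' a)) =
      ∏ a ∈ A, (if (ρ a, a) ∈ T1 then (1 : ℝ) else phi m (n' a)) := fun ρ =>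
    Finset.prod_congr rfl fun a ha => by
      by_cases h : (ρ a, a) ∈ T0
      · rw [if_pos h, if_pos ((hmem1 ρ a ha).1 h)]
      · rw [if_neg h, if_neg (fun h' => h ((hmem1 ρ a ha).2 h'))]
  have hRHS : ∏ a ∈ A, phi m (n' a + colCount T0 a) = ∏ a ∈ A, phi m (n' a + colCount T1 a) :=
    Finset.prod_congr rfl fun a ha => by rw [hcc1 a ha]
  simp_rw [hLHS]
  rw [hRHS]
  -- case analysis on the (at most two) relevant cells
  rcases Nat.lt_or_ge T1.card 1 with h0 | h1
  · -- no relevant cell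
    have hT1e : T1 = ∅ := Finset.card_eq_zero.1 (Nat.lt_one_iff.1 h0)
    rw [hT1e]
    have hc0 : ∀ a, colCount (∅ : Finset (Fin m × Fin m)) a = 0 := fun a => by simp [colCount]
    simp [hc0, Fintype.card_perm]
  rcases Nat.lt_or_ge T1.card 2 with h1' | h2
  · -- one relevant cell
    obtain ⟨x, hx⟩ := Finset.card_eq_one.1 (le_antisymm (Nat.lt_succ_iff.1 h1') h1)
    have hxA : x.2 ∈ A := hT1col x (by rw [hx]; exact Finset.mem_singleton_self _)
    exact block_step_oneCol hm T1 hT1card (a₁ := x.2) (fun y hy => by rw [hx] at hy; rw [Finset.mem_singleton.1 hy])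
      A hxA n'
  · -- two relevant cells
    obtain ⟨x, y, hxy, hT1e⟩ := Finset.card_eq_two.1 (le_antisymm hT1card h2)
    have hxA : x.2 ∈ A := hT1col x (by rw [hT1e]; exact Finset.mem_insert_self _ _)
    have hyA : y.2 ∈ A := hT1col y (by rw [hT1e]; exact Finset.mem_insert_of_mem (Finset.mem_singleton_self _))
    by_cases hcol : x.2 = y.2
    · exact block_step_oneCol hm T1 hT1card (a₁ := x.2)
        (fun z hz => by
          rw [hT1e, Finset.mem_insert, Finset.mem_singleton] at hz
          rcases hz with rfl | rfl
          · rfl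
          · exact hcol.symm)
        A hxA n'
    · have h := block_step_twoCol hm (r₁ := x.1) (r₂ := y.1) hcol A hxA hyA n'
      rw [hT1e]
      exact h

end Summit.ValiantsHypothesis.ValiantsHypothesis.Theorems.DefinabilityGapBlockStep
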